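import Literature.MathematicalPhysics.QuantumFieldTheory.Balaban1983to89.Beta.VectorPropagatorDict

/-!
# Bałaban's propagator (1.83), line 3 — the longitudinal term `U^*(⊕_{p′≠0} a⁻¹Φ(p′)⁻¹ b(p′)b(p′)^*)U`:
# its position-space kernel and its WINDOW-GRADE bounds `C₀ n^{-d}`, `C₁ n^{-d-1}`, `C₂ n^{-d-2}`

HONEST FRAMING (page 1 of everything in this package): discharging `BetaPertH` makes Bałaban's UV stability
UNCONDITIONAL — a real constructive-QFT result; it is NOT the continuum limit and NOT the Clay problem.  This
module is one referee-checkable brick of the `β`-function (small-field perturbative) part of that programme: it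
certifies, from first principles and with explicit constants depending on `(d, a)` only, the size of the THIRD
LINE of Bałaban's momentum formula (1.83) for the covariant vector propagator `G = Δ_a⁻¹` at `U = 1`, as a
position-space kernel.

## The object

`Beta.VectorPropagatorDict` (dictionary row D6) proved the exact operator identity
`𝒢 = ⊕_μ Γ_μ + U^* 𝓛̂ U` (`calG_eq_gammaSum_add_longitudinal`), `𝓛̂ = ⊕_{p′} 𝓛̂(p′)`,
`𝓛̂(p′)_{(l,μ),(l′,ν)} = a⁻¹Φ(p′)⁻¹ b(l,μ) \overline{b(l′,ν)}` for `p′ ≠ 0` and `𝓛̂(0) = 0`, where `b(l,μ)` is the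
square bracket of (1.83),
  «[ ∂_μ(p′+l) ū(p′+l) / (Δ(p′+l)² X(p′)) − a \overline{u(p′+l) v_μ(p′+l)} ∂_{1,μ}(p′) / (φ_μ(p′) Δ(p′+l)) ]»
[cite: Balaban1984PropagatorsI, (1.83) p.31], and that the same operator is the Woodbury longitudinal term
`(⊕Γ)(∂P)C⁻¹(∂P)ᴴ(⊕Γ)` (`longitudinal_eq`).  NO BOUND on it was asserted there.  Here we supply the bounds.

## What is certified here (zero `sorry`, every `d ≥ 1`, all periods `M`, every `a > 0`, every `n ≥ 1`)

* §1 (abstract fibre `F`, hypotheses E1–E4 of `B5Prop11Bound.Fiber` only): the LEG BOUNDS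
  `|b(0,μ)| ≤ L_o Δ₀(p′)^{3/2}` (`norm_b_o_le` — THE CANCELLATION (1.88) AT `l = 0`: `b(0,μ) = ∂_μ(p′)ū(p′) r_μ`,
  `r_μ = Br_μ/(Δ(p′)²X φ_μ)`, `|Br_μ| ≤ B`, pass 5's `Fiber.r_eq`/`abs_Br_le`),
  `|b(l,μ)| ≤ L_off Δ₀(p′)^{3/2} |u(p′+l)|/Δ(p′+l)` for `l ≠ 0` (`norm_b_off_le`), hence
  `Σ_l |b(l,μ)| ≤ (L_o + L_off A₁) Δ₀^{3/2}` and `Σ_l |b(l,μ)| √Δ(p′+l) ≤ (2dκL_o + L_off A₂) Δ₀^{3/2}` with the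
  off-centre alias sums `A₁ = Σ_{l≠0}|u|/Δ`, `A₂ = Σ_{l≠0}|u|/√Δ`; and `|a⁻¹Φ⁻¹|·S·S′ ≤ (γ₊CC′/a)·Δ₀(p′)` for legs
  `S ≤ CΔ₀^{3/2}`, `S′ ≤ C′Δ₀^{3/2}` (`cT_mul_legs_le`, from pass 5's `cT_le : a⁻¹Φ⁻¹ ≤ γ₊/(aΔ₀²)`).
* §2 THE KERNEL FORMULA (`kernel_eq`, pure finite Fourier analysis):
  `(U^*𝓛̂U)((x,μ),(x′,ν)) = |T|⁻¹ Σ_{p′≠0} a⁻¹Φ(p′)⁻¹ β_{p′}(x,μ) \overline{β_{p′}(x′,ν)}`,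
  `β_{p′}(x,μ) = Σ_l e^{i(p′+l)·x} b(l,μ)` (`lamp`), via the general conjugated-block-diagonal kernel
  `conj_blockDiagonal_apply`; the kernels of `𝒢 − ⊕Γ` and of the Woodbury term are this `𝓛` (`calG_sub_gammaSum_apply`,
  `woodbury_apply`).
* §3 THE BOUNDS, with B5's fibres (`B5FiberQQ.fiberAt`: `c_u = (4/π²)^d`, `c_uv = (4/π²)^{d+1}`, `κ = π²/4`) and
  King's alias sums (`WoodburyFibre.offCentre_sum_le`/`offCentre_sqrt_sum_le`: `A₁ ≤ C_Y(d)`, `A₂ ≤ C′_Y(d)`,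
  [cite: King1986, (4.22) p.672]):
  (G22-c) `|a⁻¹Φ(p′)⁻¹ β_{p′}(x,μ) \overline{β_{p′}(x′,ν)}| ≤ (γ₊ L_b²/a) · Δ₀(p′)` (`fibre_term_lamp_le`) — the fibre
  term of line 3 VANISHES TO SECOND ORDER at `p′ = 0` (`Δ₀(p′) = Σ_μ(2 − 2cos p′_μ)`, `Δ₀_fiberAt_eq`): there is NO
  small denominator in line 3;
  (K0) `|𝓛((x,μ),(x′,ν))| ≤ C₀(d,a)/n^d` (`norm_Lker_le`);
  (K1) `|𝓛((x+e_ρ,μ),(x′,ν)) − 𝓛((x,μ),(x′,ν))| ≤ C₁(d,a)/n^{d+1}`, same in the second leg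
  (`norm_Lker_sub_left_le`, `norm_Lker_sub_right_le`; one lattice difference costs `|e^{i(p′+l)·e_ρ} − 1| ≤ √Δ(p′+l)/n`,
  `WoodburyFibre.norm_chi_unitVec_sub_one_le` + `King1986.lapSym_pOf`);
  (K2) `|∇_ρ∇′_{ρ′}𝓛| ≤ C₂(d,a)/n^{d+2}` (`norm_Lker_sub_sub_le`);
  `C₀ = 4dγ₊L_b²/a`, `C₁ = 4dγ₊L_bL′_b/a`, `C₂ = 4dγ₊L′_b²/a`, `γ₊ = 4d + a + ad`, `L_b = L_o + L_off C_Y(d)`,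
  `L′_b = 2dκL_o + L_off C′_Y(d)`, `L_o = Bκ²/(a c_u c_uv)`, `L_off = κ²d/c_u + κ/c_uv`, `B = 1 + a/4 + adκ/4`.

Bałaban, p. 32–33, on this term: «Again taking into account the cancellation of the terms with l″ = l the above
expression is well defined by continuity for p′ = 0, and we even get an additional factor Δ₀(p′). Because there are
two expressions in square brackets in the considered term, we get the additional factor Δ₀²(p′). This factor
multiplying the function between the square bracket expressions gives an inverse of the expression (1.86) which is
also well defined. Thus the third term is well defined by continuity at p′ = 0 and defines a bounded operator
together with its derivatives up to the second order.» [cite: Balaban1984PropagatorsI, (1.88) p.32–33].  The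
present module is a kernel (pointwise) form of exactly this paragraph, with one more factor `Δ₀^{1/2}` per bracket
(from `|∂_μ(p′)| ≤ κ√Δ₀`, `|∂_{1,μ}| ≤ √Δ₀`) — so the summed kernel is flat of size `|T_coarse|·n^{-d}|T_coarse|⁻¹ =
n^{-d}` WITHOUT any shell sum over `p′` (contrast lines 1–2, whose `p′`-sum needs the `d = 4` shell sums of
`WoodburyFibre`).  The operator-norm statement «‖GJ‖, ‖∇GJ‖, …, ‖G∇*∇*J‖ ≤ γ₀⁻¹‖J‖» is Proposition 1.1,
[cite: Balaban1984PropagatorsI, (1.89) p.33]; we do not use it.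

## Grade, units, and what is NOT certified here

* UNITS: `calG` is in the `n = η⁻¹ = L^k` scaling of `B5Prop11Plancherel` (`c = n²` in King's symbol; one lattice
  step = `unitVec`).  In `d = 4` the flat size `n^{-4}` and the gains `n^{-1}` per difference are exactly the grade of
  the window REMAINDER of the `β`-road (`WoodburyFibre`'s `Rperp = O(N⁻⁴)`; `ComposedRoad` §4's
  `R/(‖w‖^{a−2} L²)` with `‖w‖ ≤ M(L) ≤ L`): line 3 enters ONLY the vector instantiation of the leg binders at
  window-remainder grade (lead ruling R12-2); it is NOT pure gauge (R12-1) and it is not dropped.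
* NOT certified here: (i) the exponential TAILS of line 3 beyond the window (the `e^{−δ|x−x′|}` decay of
  Proposition 1.2, [cite: Balaban1984PropagatorsI, (1.110) p.35]) — cited elsewhere, not proved; (ii) the
  torus-entry ↦ `Pt` adapter feeding `ComposedRoad.window_of_scaleFamily` (parked); (iii) lines 1–2 of (1.83)
  (`WoodburyFibre`, `WoodburyCovariant` §10); (iv) anything at `U ≠ 1`.
* No hypothesis of this file is an internally-minted statement: the inputs are pass 5's kernel-checked fibre algebra
  (`B5Prop11Bound`, E1–E4 discharged in `B5Prop11Fiber.balabanFiber`), King's kernel-checked alias sums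
  (`WoodburyFibre` §2) and finite Fourier analysis.
-/

noncomputable section

open Finset
open Matrix hiding comp gram
open scoped BigOperators ComplexConjugate Matrix

namespace Literature.MathematicalPhysics.QuantumFieldTheory.Balaban1983to89.Beta.LongitudinalWindow

open Literature.MathematicalPhysics.QuantumFieldTheory.King1986.Torus (lapSym u lapSym_pOf)
open Literature.MathematicalPhysics.QuantumFieldTheory.Balaban1983to89.B5Prop11Plancherel
open Literature.MathematicalPhysics.QuantumFieldTheory.Balaban1983to89.B5Prop11Inverse (bv)
open Literature.MathematicalPhysics.QuantumFieldTheory.Balaban1983to89.B5Prop11Bound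
open Literature.MathematicalPhysics.QuantumFieldTheory.Balaban1983to89.B5Prop11Fiber (uSym norm_uSym_sq Delta0_eq)
open Literature.MathematicalPhysics.QuantumFieldTheory.Balaban1983to89.B4Strip (DeltaXir shiftr Ur Delta1r)
open Literature.MathematicalPhysics.QuantumFieldTheory.Balaban1983to89.B5Block118 (pOf pOf_injective pOf_bijective card_kq)
open Literature.MathematicalPhysics.QuantumFieldTheory.Balaban1983to89.Beta.VectorPropagatorDict
open Literature.MathematicalPhysics.QuantumFieldTheory.Balaban1983to89.Beta.WoodburyFibre (aliasC aliasC2 aliasC_nonneg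
  aliasC2_nonneg offCentre_sum_le offCentre_sqrt_sum_le norm_chi norm_chi_unitVec_sub_one_le)

/-! ## §1 The fibre legs of line 3 of (1.83): `Σ_l |b(l,μ)| ≤ L_b · Δ₀(p′)^{3/2}` — the cancellation (1.88) at `l = 0`,
alias suppression off centre; abstract fibre `F` (E1–E4 only) -/

section Fibre

variable {Λ : Type*} [Fintype Λ] [DecidableEq Λ] {d : ℕ} (F : B5Prop11Bound.Fiber Λ d)

/-- the CENTRAL leg coefficient `L_o = B κ² /(a c_u c_uv)` (`B = Bconst`). [folklore] -/
def Lo (d : ℕ) (a cu cuv κ : ℝ) : ℝ := Bconst d a κ * κ ^ 2 / (a * cu * cuv)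

/-- the OFF-CENTRE leg coefficient `L_off = κ² d / c_u + κ / c_uv`. [folklore] -/
def Loff (d : ℕ) (cu cuv κ : ℝ) : ℝ := κ ^ 2 * d / cu + κ / cuv

/-- `|∂_{1,μ}(p′)| ≤ √Δ₀(p′)`. [folklore] -/
theorem norm_e₁_le_sqrt (μ : Fin d) : ‖F.e₁ μ‖ ≤ Real.sqrt F.Δ₀ := by
  have h : ‖F.e₁ μ‖ ^ 2 ≤ F.Δ₀ := by
    rw [Fiber.Δ₀_def]
    exact Finset.single_le_sum (f := fun ν => ‖F.e₁ ν‖ ^ 2) (fun _ _ => sq_nonneg _) (Finset.mem_univ μ)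
  have := Real.abs_le_sqrt h
  rwa [abs_of_nonneg (norm_nonneg _)] at this

/-- `√Δ₀(p′) ≤ 2d` (from `Δ₀ ≤ 4d ≤ 4d²`; `d ≥ 1` since `Δ₀ > 0`). [folklore] -/
theorem sqrt_Δ₀_le : Real.sqrt F.Δ₀ ≤ 2 * d := by
  have hd1 : (1 : ℝ) ≤ d := by
    have h0 := F.Δ₀_pos'
    rw [Fiber.Δ₀_def] at h0
    rcases Nat.eq_zero_or_pos d with hd | hd
    · subst hd
      simp at h0
    · exact_mod_cast hd
  have h : F.Δ₀ ≤ (2 * d) ^ 2 := by nlinarith [F.Δ₀_le]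
  calc Real.sqrt F.Δ₀ ≤ Real.sqrt ((2 * d) ^ 2) := Real.sqrt_le_sqrt h
    _ = 2 * d := Real.sqrt_sq (by positivity)

/-- `Δ₀² ≤ 2d · Δ₀ √Δ₀`. [folklore] -/
theorem Δ₀_sq_le : F.Δ₀ ^ 2 ≤ 2 * d * (F.Δ₀ * Real.sqrt F.Δ₀) := by
  have h0 := F.Δ₀_pos'.le
  have hs : Real.sqrt F.Δ₀ * Real.sqrt F.Δ₀ = F.Δ₀ := Real.mul_self_sqrt h0
  have hs0 := Real.sqrt_nonneg F.Δ₀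
  have h1 := sqrt_Δ₀_le F
  calc F.Δ₀ ^ 2 = Real.sqrt F.Δ₀ * (F.Δ₀ * Real.sqrt F.Δ₀) := by linear_combination (-F.Δ₀) * hs
    _ ≤ 2 * d * (F.Δ₀ * Real.sqrt F.Δ₀) := mul_le_mul_of_nonneg_right h1 (mul_nonneg h0 hs0)

/-- `κΔ₀ ≤ κ²Δ₀` (`κ ≥ 1`). [folklore] -/
theorem κΔ₀_le : F.κ * F.Δ₀ ≤ F.κ ^ 2 * F.Δ₀ := by
  have h0 := F.Δ₀_pos'.le
  have hκ := F.one_le_κ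
  calc F.κ * F.Δ₀ = 1 * (F.κ * F.Δ₀) := by ring
    _ ≤ F.κ * (F.κ * F.Δ₀) := mul_le_mul_of_nonneg_right hκ (mul_nonneg F.κ_pos.le h0)
    _ = F.κ ^ 2 * F.Δ₀ := by ring

/-- `|∂_μ(p′)| ≤ κ √Δ₀(p′)` (from `|∂_μ(p′)|² ≤ Δ(p′) ≤ κΔ₀ ≤ κ²Δ₀`). [folklore] -/
theorem norm_e_o_le_sqrt (μ : Fin d) : ‖F.e μ F.o‖ ≤ F.κ * Real.sqrt F.Δ₀ := by
  have h0 := F.Δ₀_pos'.le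
  have hκ := F.one_le_κ
  have h2 : ‖F.e μ F.o‖ ^ 2 ≤ (F.κ * Real.sqrt F.Δ₀) ^ 2 := by
    rw [mul_pow, Real.sq_sqrt h0]
    calc ‖F.e μ F.o‖ ^ 2 ≤ F.Δ F.o := F.norm_e_sq_le μ F.o
      _ ≤ F.κ * F.Δ₀ := F.Δo_le'
      _ ≤ F.κ ^ 2 * F.Δ₀ := κΔ₀_le F
  exact (pow_le_pow_iff_left₀ (norm_nonneg _) (mul_nonneg F.κ_pos.le (Real.sqrt_nonneg _))
    two_ne_zero).mp h2

/-- `|r_μ| ≤ B κ Δ₀ /(c_u a c_uv)` — the cancellation (1.88) at `l = 0` (`r = Br/(Δ(p′)²Xφ_μ)`, `|Br| ≤ B`,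
`Δ(p′)²X ≥ c_u`, `φ_μ⁻¹ ≤ κΔ₀/(a c_uv)`). [cite: Balaban1984PropagatorsI, (1.88) p.32] -/
theorem abs_r_le (μ : Fin d) : |F.r μ| ≤ Bconst d F.a F.κ * (1 / F.cu) * (F.κ * F.Δ₀ / (F.a * F.cuv)) := by
  have hΔ := F.Δo_pos
  have hX := F.X_pos
  have hφ := F.φ_pos μ
  have hcu := F.cu_pos
  have hden : 0 < F.Δ F.o ^ 2 * F.X * F.φ μ := mul_pos (mul_pos (pow_pos hΔ 2) hX) hφ
  rw [Fiber.r_eq, abs_div, abs_of_pos hden]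
  have t2 : 1 / (F.Δ F.o ^ 2 * F.X) ≤ 1 / F.cu := by
    apply one_div_le_one_div_of_le hcu
    have h := F.cu_div_le_X
    rw [div_le_iff₀ (pow_pos hΔ 2)] at h
    linarith
  have t3 : |F.Br μ| ≤ Bconst d F.a F.κ := F.abs_Br_le μ
  have t4 : 1 / F.φ μ ≤ F.κ * F.Δ₀ / (F.a * F.cuv) := F.inv_φ_le μ
  have e : |F.Br μ| / (F.Δ F.o ^ 2 * F.X * F.φ μ) = |F.Br μ| * (1 / (F.Δ F.o ^ 2 * F.X)) * (1 / F.φ μ) := by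
    field_simp
  rw [e]
  have nB := F.Bconst_nonneg
  exact mul_le_mul (mul_le_mul t3 t2 (by positivity) nB) t4 (by positivity) (mul_nonneg nB (by positivity))

/-- `L_o ≥ 0`. [folklore] -/
theorem Lo_nonneg : 0 ≤ Lo d F.a F.cu F.cuv F.κ := by
  unfold Lo
  exact div_nonneg (mul_nonneg F.Bconst_nonneg (sq_nonneg _))
    (mul_nonneg (mul_nonneg F.a_pos.le F.cu_pos.le) F.cuv_pos.le)

/-- `L_off ≥ 0`. [folklore] -/
theorem Loff_nonneg : 0 ≤ Loff d F.cu F.cuv F.κ := by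
  unfold Loff
  have hκ := F.κ_pos.le
  exact add_nonneg (div_nonneg (by positivity) F.cu_pos.le) (div_nonneg hκ F.cuv_pos.le)

/-- **THE CENTRAL LEG**: `|b(0,μ)| ≤ L_o · Δ₀(p′)√Δ₀(p′)` — degree `3/2` in `p′`, by the cancellation (1.88).
[cite: Balaban1984PropagatorsI, (1.88) p.32] -/
theorem norm_b_o_le (μ : Fin d) : ‖F.b F.o μ‖ ≤ Lo d F.a F.cu F.cuv F.κ * (F.Δ₀ * Real.sqrt F.Δ₀) := by
  rw [Fiber.norm_b_o]
  have h1 := norm_e_o_le_sqrt F μ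
  have h2 := F.norm_u_le F.o
  have h3 := abs_r_le F μ
  have hκ := F.κ_pos.le
  have hs0 := Real.sqrt_nonneg F.Δ₀
  have nB := F.Bconst_nonneg
  have ha := F.a_pos
  have hcu := F.cu_pos
  have hcuv := F.cuv_pos
  calc ‖F.e μ F.o‖ * ‖F.u F.o‖ * |F.r μ|
      ≤ F.κ * Real.sqrt F.Δ₀ * 1 * (Bconst d F.a F.κ * (1 / F.cu) * (F.κ * F.Δ₀ / (F.a * F.cuv))) :=
        mul_le_mul (mul_le_mul h1 h2 (norm_nonneg _) (mul_nonneg hκ hs0)) h3 (abs_nonneg _)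
          (mul_nonneg (mul_nonneg hκ hs0) zero_le_one)
    _ = Lo d F.a F.cu F.cuv F.κ * (F.Δ₀ * Real.sqrt F.Δ₀) := by
        unfold Lo
        field_simp

/-- **THE OFF-CENTRE LEGS**: `|b(l,μ)| ≤ L_off · Δ₀(p′)√Δ₀(p′) · |u(p′+l)|/Δ(p′+l)` for `l ≠ 0`
(`X⁻¹ ≤ Δ(p′)²/c_u ≤ κ²Δ₀²/c_u`, `|∂_μ(p′+l)| ≤ Δ(p′+l)/2`, `φ_μ⁻¹ ≤ κΔ₀/(a c_uv)`, `|∂_{1,μ}| ≤ √Δ₀`). [folklore] -/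
theorem norm_b_off_le {l : Λ} (hl : l ≠ F.o) (μ : Fin d) :
    ‖F.b l μ‖ ≤ Loff d F.cu F.cuv F.κ * (F.Δ₀ * Real.sqrt F.Δ₀) * (‖F.u l‖ / F.Δ l) := by
  have hΔ := F.Δ_pos l
  have hX := F.X_pos
  have hφ := F.φ_pos μ
  have ha := F.a_pos
  have hcu := F.cu_pos
  have hcuv := F.cuv_pos
  have hΔ' : F.Δ l ≠ 0 := hΔ.ne'
  have hX' : F.X ≠ 0 := hX.ne'
  have hφ' : F.φ μ ≠ 0 := hφ.ne'
  have ha' : F.a ≠ 0 := ha.ne'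
  have hd : (0 : ℝ) ≤ d := Nat.cast_nonneg d
  have he := F.norm_e_le_half hl μ
  have huv := F.norm_uv_le μ l
  have he₁ := norm_e₁_le_sqrt F μ
  have hs0 := Real.sqrt_nonneg F.Δ₀
  have hD0 := F.Δ₀_pos'.le
  have hu0 := norm_nonneg (F.u l)
  -- the two terms of `b`
  have hb : ‖F.b l μ‖ ≤ ‖F.e μ l‖ * ‖F.u l‖ / (F.Δ l ^ 2 * F.X)
      + F.a * ‖F.u l * F.v μ l‖ * ‖F.e₁ μ‖ / (F.φ μ * F.Δ l) := by
    rw [Fiber.b]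
    refine (norm_sub_le _ _).trans (le_of_eq ?_)
    simp only [norm_div, norm_mul, norm_pow, Complex.norm_conj, Complex.norm_of_nonneg hΔ.le,
      Complex.norm_of_nonneg hX.le, Complex.norm_of_nonneg ha.le, Complex.norm_of_nonneg hφ.le]
  -- term 1
  have hXi : 1 / F.X ≤ F.Δ F.o ^ 2 / F.cu := F.inv_X_le
  have hΔo : F.Δ F.o ^ 2 ≤ F.κ ^ 2 * F.Δ₀ ^ 2 := by
    rw [← mul_pow]
    exact pow_le_pow_left₀ F.Δo_pos.le F.Δo_le' 2
  have hΔ₀ : F.Δ₀ ^ 2 ≤ 2 * d * (F.Δ₀ * Real.sqrt F.Δ₀) := Δ₀_sq_le F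
  have term1 : ‖F.e μ l‖ * ‖F.u l‖ / (F.Δ l ^ 2 * F.X)
      ≤ F.κ ^ 2 * d / F.cu * (F.Δ₀ * Real.sqrt F.Δ₀) * (‖F.u l‖ / F.Δ l) := by
    have s1 : ‖F.e μ l‖ * ‖F.u l‖ / (F.Δ l ^ 2 * F.X) ≤ F.Δ l / 2 * ‖F.u l‖ / (F.Δ l ^ 2 * F.X) := by
      apply div_le_div_of_nonneg_right _ (mul_pos (pow_pos hΔ 2) hX).le
      exact mul_le_mul_of_nonneg_right he hu0
    have s2 : F.Δ l / 2 * ‖F.u l‖ / (F.Δ l ^ 2 * F.X) = ‖F.u l‖ / F.Δ l / 2 * (1 / F.X) := by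
      field_simp
    have s3 : ‖F.u l‖ / F.Δ l / 2 * (1 / F.X) ≤ ‖F.u l‖ / F.Δ l / 2 * (F.κ ^ 2 * (2 * d * (F.Δ₀ * Real.sqrt F.Δ₀)) / F.cu) := by
      apply mul_le_mul_of_nonneg_left _ (by positivity)
      calc 1 / F.X ≤ F.Δ F.o ^ 2 / F.cu := hXi
        _ ≤ F.κ ^ 2 * F.Δ₀ ^ 2 / F.cu := div_le_div_of_nonneg_right hΔo hcu.le
        _ ≤ F.κ ^ 2 * (2 * d * (F.Δ₀ * Real.sqrt F.Δ₀)) / F.cu :=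
            div_le_div_of_nonneg_right (mul_le_mul_of_nonneg_left hΔ₀ (sq_nonneg _)) hcu.le
    calc ‖F.e μ l‖ * ‖F.u l‖ / (F.Δ l ^ 2 * F.X)
        ≤ F.Δ l / 2 * ‖F.u l‖ / (F.Δ l ^ 2 * F.X) := s1
      _ = ‖F.u l‖ / F.Δ l / 2 * (1 / F.X) := s2
      _ ≤ ‖F.u l‖ / F.Δ l / 2 * (F.κ ^ 2 * (2 * d * (F.Δ₀ * Real.sqrt F.Δ₀)) / F.cu) := s3
      _ = F.κ ^ 2 * d / F.cu * (F.Δ₀ * Real.sqrt F.Δ₀) * (‖F.u l‖ / F.Δ l) := by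
          field_simp
  -- term 2
  have hφi : 1 / F.φ μ ≤ F.κ * F.Δ₀ / (F.a * F.cuv) := F.inv_φ_le μ
  have term2 : F.a * ‖F.u l * F.v μ l‖ * ‖F.e₁ μ‖ / (F.φ μ * F.Δ l)
      ≤ F.κ / F.cuv * (F.Δ₀ * Real.sqrt F.Δ₀) * (‖F.u l‖ / F.Δ l) := by
    have s1 : F.a * ‖F.u l * F.v μ l‖ * ‖F.e₁ μ‖ / (F.φ μ * F.Δ l)
        ≤ F.a * ‖F.u l‖ * Real.sqrt F.Δ₀ / (F.φ μ * F.Δ l) := by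
      apply div_le_div_of_nonneg_right _ (mul_pos hφ hΔ).le
      exact mul_le_mul (mul_le_mul_of_nonneg_left huv ha.le) he₁ (norm_nonneg _) (mul_nonneg ha.le hu0)
    have s2 : F.a * ‖F.u l‖ * Real.sqrt F.Δ₀ / (F.φ μ * F.Δ l)
        = F.a * (‖F.u l‖ / F.Δ l) * Real.sqrt F.Δ₀ * (1 / F.φ μ) := by
      field_simp
    have s3 : F.a * (‖F.u l‖ / F.Δ l) * Real.sqrt F.Δ₀ * (1 / F.φ μ)
        ≤ F.a * (‖F.u l‖ / F.Δ l) * Real.sqrt F.Δ₀ * (F.κ * F.Δ₀ / (F.a * F.cuv)) :=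
      mul_le_mul_of_nonneg_left hφi (by positivity)
    calc F.a * ‖F.u l * F.v μ l‖ * ‖F.e₁ μ‖ / (F.φ μ * F.Δ l)
        ≤ F.a * ‖F.u l‖ * Real.sqrt F.Δ₀ / (F.φ μ * F.Δ l) := s1
      _ = F.a * (‖F.u l‖ / F.Δ l) * Real.sqrt F.Δ₀ * (1 / F.φ μ) := s2
      _ ≤ F.a * (‖F.u l‖ / F.Δ l) * Real.sqrt F.Δ₀ * (F.κ * F.Δ₀ / (F.a * F.cuv)) := s3
      _ = F.κ / F.cuv * (F.Δ₀ * Real.sqrt F.Δ₀) * (‖F.u l‖ / F.Δ l) := by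
          field_simp
  calc ‖F.b l μ‖
      ≤ ‖F.e μ l‖ * ‖F.u l‖ / (F.Δ l ^ 2 * F.X) + F.a * ‖F.u l * F.v μ l‖ * ‖F.e₁ μ‖ / (F.φ μ * F.Δ l) := hb
    _ ≤ F.κ ^ 2 * d / F.cu * (F.Δ₀ * Real.sqrt F.Δ₀) * (‖F.u l‖ / F.Δ l)
          + F.κ / F.cuv * (F.Δ₀ * Real.sqrt F.Δ₀) * (‖F.u l‖ / F.Δ l) := add_le_add term1 term2
    _ = Loff d F.cu F.cuv F.κ * (F.Δ₀ * Real.sqrt F.Δ₀) * (‖F.u l‖ / F.Δ l) := by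
        unfold Loff
        ring

/-- the off-centre alias sums `A₁ = Σ_{l≠0}|u(p′+l)|/Δ(p′+l)`, `A₂ = Σ_{l≠0}|u(p′+l)|/√Δ(p′+l)` of a fibre. [folklore] -/
def A₁ : ℝ := ∑ l ∈ univ.erase F.o, ‖F.u l‖ / F.Δ l

/-- see `A₁`. [folklore] -/
def A₂ : ℝ := ∑ l ∈ univ.erase F.o, ‖F.u l‖ / Real.sqrt (F.Δ l)

/-- `A₁ ≥ 0`. [folklore] -/
theorem A₁_nonneg : 0 ≤ A₁ F := Finset.sum_nonneg fun l _ => div_nonneg (norm_nonneg _) (F.Δ_pos l).le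

/-- `A₂ ≥ 0`. [folklore] -/
theorem A₂_nonneg : 0 ≤ A₂ F := Finset.sum_nonneg fun _ _ => div_nonneg (norm_nonneg _) (Real.sqrt_nonneg _)

/-- **LEG SUM**: `Σ_l |b(l,μ)| ≤ (L_o + L_off A₁) · Δ₀√Δ₀`. [folklore] -/
theorem sum_norm_b_le (μ : Fin d) :
    ∑ l, ‖F.b l μ‖ ≤ (Lo d F.a F.cu F.cuv F.κ + Loff d F.cu F.cuv F.κ * A₁ F) * (F.Δ₀ * Real.sqrt F.Δ₀) := by
  rw [← Finset.add_sum_erase _ _ (Finset.mem_univ F.o)]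
  have h1 := norm_b_o_le F μ
  have h2 : ∑ l ∈ univ.erase F.o, ‖F.b l μ‖
      ≤ ∑ l ∈ univ.erase F.o, Loff d F.cu F.cuv F.κ * (F.Δ₀ * Real.sqrt F.Δ₀) * (‖F.u l‖ / F.Δ l) :=
    Finset.sum_le_sum fun l hl => norm_b_off_le F (Finset.ne_of_mem_erase hl) μ
  rw [← Finset.mul_sum] at h2
  calc ‖F.b F.o μ‖ + ∑ l ∈ univ.erase F.o, ‖F.b l μ‖
      ≤ Lo d F.a F.cu F.cuv F.κ * (F.Δ₀ * Real.sqrt F.Δ₀)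
          + Loff d F.cu F.cuv F.κ * (F.Δ₀ * Real.sqrt F.Δ₀) * A₁ F := add_le_add h1 h2
    _ = _ := by unfold A₁; ring

/-- **WEIGHTED LEG SUM** (for one lattice difference): `Σ_l |b(l,μ)| √Δ(p′+l) ≤ (2dκ L_o + L_off A₂) · Δ₀√Δ₀`.
[folklore] -/
theorem sum_norm_b_sqrt_le (μ : Fin d) :
    ∑ l, ‖F.b l μ‖ * Real.sqrt (F.Δ l)
      ≤ (2 * d * F.κ * Lo d F.a F.cu F.cuv F.κ + Loff d F.cu F.cuv F.κ * A₂ F) * (F.Δ₀ * Real.sqrt F.Δ₀) := by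
  rw [← Finset.add_sum_erase _ _ (Finset.mem_univ F.o)]
  have hD0 := F.Δ₀_pos'.le
  have hs0 := Real.sqrt_nonneg F.Δ₀
  have hκ := F.κ_pos.le
  have hLo := Lo_nonneg F
  -- centre: `√Δ(p′) ≤ κ√Δ₀` hence `|b(0,μ)|√Δ(p′) ≤ L_o Δ₀√Δ₀ · κ√Δ₀ ≤ 2dκ L_o Δ₀√Δ₀`
  have hc1 : Real.sqrt (F.Δ F.o) ≤ F.κ * Real.sqrt F.Δ₀ := by
    have h2 : F.Δ F.o ≤ (F.κ * Real.sqrt F.Δ₀) ^ 2 := by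
      rw [mul_pow, Real.sq_sqrt hD0]
      calc F.Δ F.o ≤ F.κ * F.Δ₀ := F.Δo_le'
        _ ≤ F.κ ^ 2 * F.Δ₀ := κΔ₀_le F
    calc Real.sqrt (F.Δ F.o) ≤ Real.sqrt ((F.κ * Real.sqrt F.Δ₀) ^ 2) := Real.sqrt_le_sqrt h2
      _ = F.κ * Real.sqrt F.Δ₀ := Real.sqrt_sq (mul_nonneg hκ hs0)
  have hc2 : F.Δ₀ * Real.sqrt F.Δ₀ * (F.κ * Real.sqrt F.Δ₀) ≤ 2 * d * F.κ * (F.Δ₀ * Real.sqrt F.Δ₀) := by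
    have e : F.Δ₀ * Real.sqrt F.Δ₀ * (F.κ * Real.sqrt F.Δ₀) = F.κ * F.Δ₀ ^ 2 := by
      have := Real.mul_self_sqrt hD0
      linear_combination (F.κ * F.Δ₀) * this
    rw [e]
    have := Δ₀_sq_le F
    nlinarith
  have h1 : ‖F.b F.o μ‖ * Real.sqrt (F.Δ F.o) ≤ 2 * d * F.κ * Lo d F.a F.cu F.cuv F.κ * (F.Δ₀ * Real.sqrt F.Δ₀) := by
    calc ‖F.b F.o μ‖ * Real.sqrt (F.Δ F.o)
        ≤ Lo d F.a F.cu F.cuv F.κ * (F.Δ₀ * Real.sqrt F.Δ₀) * (F.κ * Real.sqrt F.Δ₀) :=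
          mul_le_mul (norm_b_o_le F μ) hc1 (Real.sqrt_nonneg _) (mul_nonneg hLo (mul_nonneg hD0 hs0))
      _ = Lo d F.a F.cu F.cuv F.κ * (F.Δ₀ * Real.sqrt F.Δ₀ * (F.κ * Real.sqrt F.Δ₀)) := by ring
      _ ≤ Lo d F.a F.cu F.cuv F.κ * (2 * d * F.κ * (F.Δ₀ * Real.sqrt F.Δ₀)) := mul_le_mul_of_nonneg_left hc2 hLo
      _ = _ := by ring
  -- off centre: `(|u|/Δ)·√Δ = |u|/√Δ`
  have h2 : ∑ l ∈ univ.erase F.o, ‖F.b l μ‖ * Real.sqrt (F.Δ l)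
      ≤ ∑ l ∈ univ.erase F.o, Loff d F.cu F.cuv F.κ * (F.Δ₀ * Real.sqrt F.Δ₀) * (‖F.u l‖ / Real.sqrt (F.Δ l)) := by
    refine Finset.sum_le_sum fun l hl => ?_
    have hΔ := F.Δ_pos l
    have hsq : 0 < Real.sqrt (F.Δ l) := Real.sqrt_pos.mpr hΔ
    have e : ‖F.u l‖ / Real.sqrt (F.Δ l) = ‖F.u l‖ / F.Δ l * Real.sqrt (F.Δ l) := by
      rw [div_mul_eq_mul_div, div_eq_div_iff hsq.ne' hΔ.ne', mul_assoc, Real.mul_self_sqrt hΔ.le]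
    rw [e, ← mul_assoc]
    exact mul_le_mul_of_nonneg_right (norm_b_off_le F (Finset.ne_of_mem_erase hl) μ) hsq.le
  rw [← Finset.mul_sum] at h2
  calc ‖F.b F.o μ‖ * Real.sqrt (F.Δ F.o) + ∑ l ∈ univ.erase F.o, ‖F.b l μ‖ * Real.sqrt (F.Δ l)
      ≤ 2 * d * F.κ * Lo d F.a F.cu F.cuv F.κ * (F.Δ₀ * Real.sqrt F.Δ₀)
          + Loff d F.cu F.cuv F.κ * (F.Δ₀ * Real.sqrt F.Δ₀) * A₂ F := add_le_add h1 h2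
    _ = _ := by unfold A₂; ring

/-- **THE FIBRE TERM OF LINE 3, WITH ITS FACTOR `Δ₀(p′)`** ((1.88): «we get the additional factor Δ₀²(p′)» against
`a⁻¹Φ⁻¹ ≤ γ₊/(aΔ₀²)`, and one more `Δ₀` from the two legs): for leg sums `S, S′ ≤ C·Δ₀√Δ₀`, `C′·Δ₀√Δ₀`,
`|cT|·S·S′ ≤ (γ₊ C C′/a)·Δ₀(p′)` — it VANISHES to second order as `p′ → 0` (no infrared singularity in line 3).
[cite: Balaban1984PropagatorsI, (1.88) p.32 (proof ours)] -/
theorem cT_mul_legs_le {S S' C C' : ℝ} (hC : 0 ≤ C) (hS0 : 0 ≤ S) (hS'0 : 0 ≤ S')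
    (hS : S ≤ C * (F.Δ₀ * Real.sqrt F.Δ₀)) (hS' : S' ≤ C' * (F.Δ₀ * Real.sqrt F.Δ₀)) :
    ‖F.cT‖ * S * S' ≤ gammaPlus d F.a * C * C' / F.a * F.Δ₀ := by
  have ha := F.a_pos
  have hD := F.Δ₀_pos'
  have hs0 := Real.sqrt_nonneg F.Δ₀
  have hγ := F.gammaPlus_pos
  rw [Fiber.norm_cT]
  have hcT := F.cT_le
  have hSS : S * S' ≤ C * (F.Δ₀ * Real.sqrt F.Δ₀) * (C' * (F.Δ₀ * Real.sqrt F.Δ₀)) :=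
    mul_le_mul hS hS' hS'0 (mul_nonneg hC (mul_nonneg hD.le hs0))
  have e : Real.sqrt F.Δ₀ * Real.sqrt F.Δ₀ = F.Δ₀ := Real.mul_self_sqrt hD.le
  calc 1 / (F.a * F.Φ) * S * S' = 1 / (F.a * F.Φ) * (S * S') := by ring
    _ ≤ gammaPlus d F.a / (F.a * F.Δ₀ ^ 2) * (C * (F.Δ₀ * Real.sqrt F.Δ₀) * (C' * (F.Δ₀ * Real.sqrt F.Δ₀))) :=
        mul_le_mul hcT hSS (mul_nonneg hS0 hS'0) (div_nonneg hγ.le (mul_pos ha (pow_pos hD 2)).le)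
    _ = gammaPlus d F.a / (F.a * F.Δ₀ ^ 2) * (C * C' * F.Δ₀ ^ 2 * (Real.sqrt F.Δ₀ * Real.sqrt F.Δ₀)) := by ring
    _ = gammaPlus d F.a * C * C' / F.a * F.Δ₀ * (F.Δ₀ ^ 2 / F.Δ₀ ^ 2) := by rw [e]; ring
    _ = gammaPlus d F.a * C * C' / F.a * F.Δ₀ := by rw [div_self (pow_ne_zero 2 hD.ne'), mul_one]

end Fibre


/-! ## §2 The position-space kernel of the longitudinal term `𝓛 = U^* 𝓛̂ U`

`𝓛̂` (`VectorPropagatorDict.calLhat`) is block diagonal over the coarse classes `q ↔ p′`, its block at `p′ ≠ 0`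
being line 3 of (1.83), `a⁻¹Φ(p′)⁻¹ b(p′) b(p′)^*` (rank one), and `0` at `p′ = 0`.  Conjugating with the
componentwise DFT `U` gives the KERNEL
`𝓛((x,μ),(x′,ν)) = |T|⁻¹ Σ_{p′≠0} a⁻¹Φ(p′)⁻¹ β_{p′}(x,μ) \overline{β_{p′}(x′,ν)}`,
`β_{p′}(x,μ) := Σ_l e^{i(p′+l)·x} b(l,μ)` (the LEG AMPLITUDE). -/

section Kernel

variable {d : ℕ} (n : ℕ) [NeZero n] (hn : 1 ≤ n) (M : Fin d → ℕ) [hM : ∀ μ, NeZero (M μ)] (a : ℝ)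
  (ha : 0 < a)

/-- `a⁻¹Φ(p′)⁻¹` at the coarse class `q ↔ p′` (`0` at `p′ = 0`, where line 3 of (1.83) is absent).
[cite: Balaban1984PropagatorsI, (1.83) p.31] -/
def cTAt (q : Tor M) : ℂ := if h : q = 0 then 0 else (B5FiberQQ.fiberAt n M hn a ha q h).cT

/-- the square bracket `b(l,μ)` of (1.83) at `p′ ↔ q`, `l ↔ k` (`0` at `p′ = 0`).
[cite: Balaban1984PropagatorsI, (1.83) p.31] -/
def bAt (q : Tor M) (k : Fin d → Fin n) (μ : Fin d) : ℂ :=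
  if h : q = 0 then 0 else (B5FiberQQ.fiberAt n M hn a ha q h).b k μ

/-- the LEG AMPLITUDE `β_{p′}(x,μ) = Σ_l e^{i(p′+l)·x} b(l,μ)`. [folklore] -/
def lamp (q : Tor M) (x : Tor (fine n M)) (μ : Fin d) : ℂ :=
  ∑ k, chi (fine n M) (pOf n M (k, q)) x * bAt n hn M a ha q k μ

/-- `cTAt` at `p′ ≠ 0` is the fibre's `a⁻¹Φ(p′)⁻¹`. [folklore] -/
theorem cTAt_of_ne {q : Tor M} (hq : q ≠ 0) : cTAt n hn M a ha q = (B5FiberQQ.fiberAt n M hn a ha q hq).cT := by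
  rw [cTAt, dif_neg hq]

/-- `bAt` at `p′ ≠ 0` is the fibre's `b(l,μ)`. [folklore] -/
theorem bAt_of_ne {q : Tor M} (hq : q ≠ 0) (k : Fin d → Fin n) (μ : Fin d) :
    bAt n hn M a ha q k μ = (B5FiberQQ.fiberAt n M hn a ha q hq).b k μ := by
  rw [bAt, dif_neg hq]

/-- `cTAt 0 = 0`. [folklore] -/
theorem cTAt_zero : cTAt n hn M a ha 0 = 0 := by
  rw [cTAt, dif_pos rfl]

/-- `bAt 0 = 0`. [folklore] -/
theorem bAt_zero (k : Fin d → Fin n) (μ : Fin d) : bAt n hn M a ha 0 k μ = 0 := by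
  rw [bAt, dif_pos rfl]

/-- the leg amplitude at `p′ = 0` is `0`. [folklore] -/
theorem lamp_zero (x : Tor (fine n M)) (μ : Fin d) : lamp n hn M a ha 0 x μ = 0 := by
  unfold lamp
  simp only [bAt_zero, mul_zero, Finset.sum_const_zero]

/-- the entries of the longitudinal blocks: `𝓛̂(p′)_{(l,μ),(l′,ν)} = a⁻¹Φ(p′)⁻¹ b(l,μ) conj b(l′,ν)`.
[cite: Balaban1984PropagatorsI, (1.83) p.31 (line 3)] -/
theorem LBlocks_apply (q : Tor M) (i j : (Fin d → Fin n) × Fin d) :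
    LBlocks n hn M a ha q i j
      = cTAt n hn M a ha q * (bAt n hn M a ha q i.1 i.2 * conj (bAt n hn M a ha q j.1 j.2)) := by
  by_cases hq : q = 0
  · subst hq
    rw [LBlocks, dif_pos rfl, cTAt_zero, Matrix.zero_apply, zero_mul]
  · rw [LBlocks, dif_neg hq, cTAt_of_ne n hn M a ha hq, bAt_of_ne n hn M a ha hq, bAt_of_ne n hn M a ha hq,
      Matrix.smul_apply, Matrix.vecMulVec_apply, Pi.star_apply, RCLike.star_def, smul_eq_mul]
    simp only [bv]

/-- `e (emb I) = I`: the block coordinates of a coset-parametrised index. [folklore] -/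
theorem blockEquiv_emb (I : ((Fin d → Fin n) × Fin d) × Tor M) : blockEquiv n M (B5Prop11Plancherel.emb n M I) = I :=
  (blockEquiv n M).apply_symm_apply I

omit [NeZero n] hM in
/-- `emb ((k,μ),q) = (P_{k,q}, μ)` for a pair variable. [folklore] -/
theorem emb_pair (K : (Fin d → Fin n) × Fin d) (q : Tor M) : B5Prop11Plancherel.emb n M (K, q) = (pOf n M (K.1, q), K.2) := rfl

/-- summing over (fine momentum, component) = summing over ((offset, component), coarse class). [folklore] -/
theorem sum_fine (f : Tor (fine n M) × Fin d → ℂ) :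
    ∑ P, f P = ∑ K : (Fin d → Fin n) × Fin d, ∑ q : Tor M, f (B5Prop11Plancherel.emb n M (K, q)) := by
  rw [← (blockEquiv n M).symm.sum_comp f, Fintype.sum_prod_type]
  rfl

/-- entries of `U^*`. [folklore] -/
theorem star_dftV_apply (N : Fin d → ℕ) [∀ μ, NeZero (N μ)] (x : Tor N) (μ : Fin d) (p : Tor N) (μ' : Fin d) :
    (star (dftV N)) (x, μ) (p, μ') = if μ' = μ then conj (dft N p x) else 0 := by
  rw [Matrix.star_apply, dftV_apply]
  split_ifs
  · rw [RCLike.star_def]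
  · rw [star_zero]

/-- pulling a constant condition out of a finite sum. [folklore] -/
theorem sum_ite_zero {α : Type*} [Fintype α] (P : Prop) [Decidable P] (f : α → ℂ) :
    ∑ x, (if P then f x else 0) = if P then ∑ x, f x else 0 := by
  split_ifs
  · rfl
  · exact Finset.sum_const_zero

/-- **THE KERNEL OF A CONJUGATED BLOCK-DIAGONAL FAMILY**: `(U^* X̂ U)((x,μ),(x′,ν)) =
Σ_{q} Σ_{k,k′} conj F(P_{k,q}, x) X(q)_{(k,μ),(k′,ν)} F(P_{k′,q}, x′)` (`F` = the normalised DFT matrix). [folklore] -/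
theorem conj_blockDiagonal_apply
    (B : Tor M → Matrix ((Fin d → Fin n) × Fin d) ((Fin d → Fin n) × Fin d) ℂ)
    (x : Tor (fine n M)) (μ : Fin d) (x' : Tor (fine n M)) (ν : Fin d) :
    (star (dftV (fine n M)) * (Matrix.reindex (blockEquiv n M) (blockEquiv n M)).symm (Matrix.blockDiagonal B)
        * dftV (fine n M)) (x, μ) (x', ν)
      = ∑ q, ∑ k, ∑ k', conj (dft (fine n M) (pOf n M (k, q)) x) * B q (k, μ) (k', ν)
          * dft (fine n M) (pOf n M (k', q)) x' := by
  -- expand both matrix products, reparametrise both index sums by cosets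
  simp only [Matrix.mul_apply, Finset.sum_mul]
  simp only [sum_fine n M]
  -- evaluate the reindexed block-diagonal matrix at coset-parametrised indices
  simp only [Matrix.reindex_symm, Matrix.reindex_apply, Equiv.symm_symm, Matrix.submatrix_apply, blockEquiv_emb,
    Matrix.blockDiagonal_apply]
  -- the coarse-class delta
  simp only [mul_ite, ite_mul, mul_zero, zero_mul, Finset.sum_ite_eq', Finset.mem_univ, if_true]
  -- the component deltas of `U`, `U^*`
  simp only [emb_pair, star_dftV_apply, dftV_apply, Fintype.sum_prod_type, mul_ite, ite_mul, mul_zero, zero_mul,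
    sum_ite_zero, Finset.sum_ite_eq', Finset.mem_univ, if_true]
  rw [Finset.sum_comm]
  exact Finset.sum_congr rfl fun q _ => Finset.sum_comm

/-- **THE POSITION-SPACE KERNEL OF THE LONGITUDINAL TERM (line 3 of (1.83))**:
`(U^* 𝓛̂ U)((x,μ),(x′,ν)) = |T|⁻¹ Σ_{p′} a⁻¹Φ(p′)⁻¹ β_{p′}(x,μ) conj β_{p′}(x′,ν)` (the `p′ = 0` term is `0`).
[cite: Balaban1984PropagatorsI, (1.83) p.31 (line 3; proof ours)] -/
theorem kernel_eq (x : Tor (fine n M)) (μ : Fin d) (x' : Tor (fine n M)) (ν : Fin d) :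
    (star (dftV (fine n M)) * calLhat n hn M a ha * dftV (fine n M)) (x, μ) (x', ν)
      = ((Fintype.card (Tor (fine n M)) : ℂ))⁻¹
          * ∑ q, cTAt n hn M a ha q * (lamp n hn M a ha q x μ * conj (lamp n hn M a ha q x' ν)) := by
  have hcpos : (0 : ℝ) < Fintype.card (Tor (fine n M)) := by exact_mod_cast Fintype.card_pos
  have hc : ((Fintype.card (Tor (fine n M)) : ℂ))⁻¹
      = (((Real.sqrt (Fintype.card (Tor (fine n M))))⁻¹ : ℝ) : ℂ)
          * (((Real.sqrt (Fintype.card (Tor (fine n M))))⁻¹ : ℝ) : ℂ) := by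
    rw [← Complex.ofReal_mul, ← mul_inv, Real.mul_self_sqrt hcpos.le, Complex.ofReal_inv, Complex.ofReal_natCast]
  rw [calLhat, conj_blockDiagonal_apply, Finset.mul_sum]
  refine Finset.sum_congr rfl fun q _ => ?_
  simp only [LBlocks_apply]
  rw [lamp, lamp, map_sum, Finset.sum_mul_sum]
  simp only [Finset.mul_sum]
  refine Finset.sum_congr rfl fun k _ => Finset.sum_congr rfl fun k' _ => ?_
  simp only [dft, map_mul, Complex.conj_ofReal, Complex.conj_conj]
  rw [hc]
  ring

/-- the FIBRE SUM functional `⟨A, B⟩_𝓛 := |T|⁻¹ Σ_{p′} a⁻¹Φ(p′)⁻¹ A(p′) conj B(p′)`. [folklore] -/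
def fsum (A B : Tor M → ℂ) : ℂ :=
  ((Fintype.card (Tor (fine n M)) : ℂ))⁻¹ * ∑ q, cTAt n hn M a ha q * (A q * conj (B q))

/-- `⟨A − A′, B⟩_𝓛 = ⟨A, B⟩_𝓛 − ⟨A′, B⟩_𝓛`. [folklore] -/
theorem fsum_sub_left (A A' B : Tor M → ℂ) :
    fsum n hn M a ha (fun q => A q - A' q) B = fsum n hn M a ha A B - fsum n hn M a ha A' B := by
  unfold fsum
  rw [← mul_sub, ← Finset.sum_sub_distrib]
  congr 1
  refine Finset.sum_congr rfl fun q _ => ?_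
  ring

/-- `⟨A, B − B′⟩_𝓛 = ⟨A, B⟩_𝓛 − ⟨A, B′⟩_𝓛`. [folklore] -/
theorem fsum_sub_right (A B B' : Tor M → ℂ) :
    fsum n hn M a ha A (fun q => B q - B' q) = fsum n hn M a ha A B - fsum n hn M a ha A B' := by
  unfold fsum
  rw [← mul_sub, ← Finset.sum_sub_distrib]
  congr 1
  refine Finset.sum_congr rfl fun q _ => ?_
  rw [map_sub]
  ring

/-- the kernel `𝓛((x,μ),(x′,ν))` of the longitudinal term `U^*𝓛̂U` (= `(⊕Γ)(∂P)C⁻¹(∂P)ᴴ(⊕Γ)` by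
`VectorPropagatorDict.longitudinal_eq`, = `𝒢 − ⊕_μΓ_μ` by `calG_eq_gammaSum_add_longitudinal`). [folklore] -/
def Lker (x : Tor (fine n M)) (μ : Fin d) (x' : Tor (fine n M)) (ν : Fin d) : ℂ :=
  (star (dftV (fine n M)) * calLhat n hn M a ha * dftV (fine n M)) (x, μ) (x', ν)

/-- `𝓛 = ⟨β(x,μ), β(x′,ν)⟩_𝓛`. [folklore] -/
theorem Lker_eq_fsum (x : Tor (fine n M)) (μ : Fin d) (x' : Tor (fine n M)) (ν : Fin d) :
    Lker n hn M a ha x μ x' ν = fsum n hn M a ha (fun q => lamp n hn M a ha q x μ) (fun q => lamp n hn M a ha q x' ν) :=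
  kernel_eq n hn M a ha x μ x' ν

/-- the kernel of `𝒢 − ⊕_μΓ_μ` is `𝓛`. [folklore] -/
theorem calG_sub_gammaSum_apply (x : Tor (fine n M)) (μ : Fin d) (x' : Tor (fine n M)) (ν : Fin d) :
    (calG n hn M a ha - gammaSum n M a) (x, μ) (x', ν) = Lker n hn M a ha x μ x' ν := by
  rw [calG_eq_gammaSum_add_longitudinal n hn M a ha, add_sub_cancel_left, Lker]

/-- the kernel of the Woodbury longitudinal term `(⊕Γ)(∂P)C⁻¹(∂P)ᴴ(⊕Γ)` is `𝓛`. [folklore] -/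
theorem woodbury_apply (x : Tor (fine n M)) (μ : Fin d) (x' : Tor (fine n M)) (ν : Fin d) :
    (gammaSum n M a * dP n M * (capacitance n M a)⁻¹ * (dP n M)ᴴ * gammaSum n M a) (x, μ) (x', ν)
      = Lker n hn M a ha x μ x' ν := by
  rw [longitudinal_eq n hn M a ha, Lker]

end Kernel

/-! ## §3 The window-grade bounds: `|𝓛| ≤ C₀/n^d`, `|∇𝓛| ≤ C₁/n^{d+1}`, `|∇∇′𝓛| ≤ C₂/n^{d+2}`, and the
per-fibre factor `Δ₀(p′)` -/

section Bounds

variable {d : ℕ} (n : ℕ) [NeZero n] (hn : 1 ≤ n) (M : Fin d → ℕ) [hM : ∀ μ, NeZero (M μ)] (a : ℝ)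
  (ha : 0 < a)

/-- `c_u = (4/π²)^d` of B5's fibres. [folklore] -/
def cuOf (d : ℕ) : ℝ := (4 / Real.pi ^ 2) ^ d

/-- `c_uv = (4/π²)^{d+1}` of B5's fibres. [folklore] -/
def cuvOf (d : ℕ) : ℝ := (4 / Real.pi ^ 2) ^ (d + 1)

/-- `κ = π²/4` of B5's fibres. [folklore] -/
def κOf : ℝ := Real.pi ^ 2 / 4

/-- the leg constant `L_b(d,a) = L_o + L_off C_Y(d)`: `Σ_l |b(l,μ)| ≤ L_b Δ₀√Δ₀`. [folklore] -/
def legC (d : ℕ) (a : ℝ) : ℝ := Lo d a (cuOf d) (cuvOf d) κOf + Loff d (cuOf d) (cuvOf d) κOf * aliasC d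

/-- the differenced-leg constant `L′_b(d,a) = 2dκ L_o + L_off C′_Y(d)`: `Σ_l |b(l,μ)|√Δ(p′+l) ≤ L′_b Δ₀√Δ₀`.
[folklore] -/
def legC2 (d : ℕ) (a : ℝ) : ℝ := 2 * d * κOf * Lo d a (cuOf d) (cuvOf d) κOf + Loff d (cuOf d) (cuvOf d) κOf * aliasC2 d

/-- `A₁ ≤ C_Y(d)` at B5's fibres — King's off-centre alias sum. [cite: King1986, (4.22) p.672] -/
theorem A₁_fiberAt_le (hd : 0 < d) {q : Tor M} (hq : q ≠ 0) : A₁ (B5FiberQQ.fiberAt n M hn a ha q hq) ≤ aliasC d :=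
  offCentre_sum_le hd hn le_rfl (abs_sOf_le M q) (fun m => ‖uSym n m (sOf M q)‖) (fun _ => norm_nonneg _)
    (fun m => norm_uSym_sq n hn m (sOf M q) (abs_sOf_le M q))

/-- `A₂ ≤ C′_Y(d)` at B5's fibres — King's off-centre alias sum, half power. [cite: King1986, (4.22) p.672] -/
theorem A₂_fiberAt_le (hd : 0 < d) {q : Tor M} (hq : q ≠ 0) : A₂ (B5FiberQQ.fiberAt n M hn a ha q hq) ≤ aliasC2 d :=
  offCentre_sqrt_sum_le hd hn le_rfl (abs_sOf_le M q) (fun m => ‖uSym n m (sOf M q)‖) (fun _ => norm_nonneg _)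
    (fun m => norm_uSym_sq n hn m (sOf M q) (abs_sOf_le M q))

/-- `γ₊ > 0`. [folklore] -/
theorem gammaPlus_pos' {a : ℝ} (ha : 0 < a) : 0 < gammaPlus d a := by
  have hd : (0 : ℝ) ≤ d := Nat.cast_nonneg d
  unfold gammaPlus
  positivity

/-- `L_b ≥ 0`. [folklore] -/
theorem legC_nonneg {a : ℝ} (ha : 0 < a) : 0 ≤ legC d a := by
  have hd : (0 : ℝ) ≤ d := Nat.cast_nonneg d
  have hA := aliasC_nonneg d
  unfold legC Lo Loff cuOf cuvOf κOf Bconst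
  positivity

/-- `L′_b ≥ 0`. [folklore] -/
theorem legC2_nonneg {a : ℝ} (ha : 0 < a) : 0 ≤ legC2 d a := by
  have hd : (0 : ℝ) ≤ d := Nat.cast_nonneg d
  have hA := aliasC2_nonneg d
  unfold legC2 Lo Loff cuOf cuvOf κOf Bconst
  positivity

/-- **LEG SUM AT A FIBRE**: `Σ_l |b(l,μ)| ≤ L_b(d,a) Δ₀(p′)√Δ₀(p′)`. [folklore] -/
theorem sum_norm_bAt_le (hd : 0 < d) {q : Tor M} (hq : q ≠ 0) (μ : Fin d) :
    ∑ k, ‖bAt n hn M a ha q k μ‖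
      ≤ legC d a * ((B5FiberQQ.fiberAt n M hn a ha q hq).Δ₀ * Real.sqrt (B5FiberQQ.fiberAt n M hn a ha q hq).Δ₀) := by
  simp only [bAt_of_ne n hn M a ha hq]
  refine (sum_norm_b_le (B5FiberQQ.fiberAt n M hn a ha q hq) μ).trans ?_
  have hA := A₁_fiberAt_le n hn M a ha hd hq
  have hD : 0 ≤ (B5FiberQQ.fiberAt n M hn a ha q hq).Δ₀ * Real.sqrt (B5FiberQQ.fiberAt n M hn a ha q hq).Δ₀ :=
    mul_nonneg (B5FiberQQ.fiberAt n M hn a ha q hq).Δ₀_pos'.le (Real.sqrt_nonneg _)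
  apply mul_le_mul_of_nonneg_right _ hD
  have hL : 0 ≤ Loff d (cuOf d) (cuvOf d) κOf := Loff_nonneg (B5FiberQQ.fiberAt n M hn a ha q hq)
  show Lo d a (cuOf d) (cuvOf d) κOf + Loff d (cuOf d) (cuvOf d) κOf * A₁ (B5FiberQQ.fiberAt n M hn a ha q hq) ≤ legC d a
  exact add_le_add le_rfl (mul_le_mul_of_nonneg_left hA hL)

/-- **WEIGHTED LEG SUM AT A FIBRE**: `Σ_l |b(l,μ)| √Δ(p′+l) ≤ L′_b(d,a) Δ₀(p′)√Δ₀(p′)`. [folklore] -/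
theorem sum_norm_b_sqrt_fiberAt_le (hd : 0 < d) {q : Tor M} (hq : q ≠ 0) (μ : Fin d) :
    ∑ k, ‖(B5FiberQQ.fiberAt n M hn a ha q hq).b k μ‖ * Real.sqrt ((B5FiberQQ.fiberAt n M hn a ha q hq).Δ k)
      ≤ legC2 d a * ((B5FiberQQ.fiberAt n M hn a ha q hq).Δ₀ * Real.sqrt (B5FiberQQ.fiberAt n M hn a ha q hq).Δ₀) := by
  refine (sum_norm_b_sqrt_le (B5FiberQQ.fiberAt n M hn a ha q hq) μ).trans ?_
  have hA := A₂_fiberAt_le n hn M a ha hd hq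
  have hD : 0 ≤ (B5FiberQQ.fiberAt n M hn a ha q hq).Δ₀ * Real.sqrt (B5FiberQQ.fiberAt n M hn a ha q hq).Δ₀ :=
    mul_nonneg (B5FiberQQ.fiberAt n M hn a ha q hq).Δ₀_pos'.le (Real.sqrt_nonneg _)
  apply mul_le_mul_of_nonneg_right _ hD
  have hL : 0 ≤ Loff d (cuOf d) (cuvOf d) κOf := Loff_nonneg (B5FiberQQ.fiberAt n M hn a ha q hq)
  show 2 * d * κOf * Lo d a (cuOf d) (cuvOf d) κOf
      + Loff d (cuOf d) (cuvOf d) κOf * A₂ (B5FiberQQ.fiberAt n M hn a ha q hq) ≤ legC2 d a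
  exact add_le_add le_rfl (mul_le_mul_of_nonneg_left hA hL)

/-- `|β_{p′}(x,μ)| ≤ Σ_l |b(l,μ)|` (`|e^{ip·x}| = 1`). [folklore] -/
theorem norm_lamp_le (q : Tor M) (x : Tor (fine n M)) (μ : Fin d) :
    ‖lamp n hn M a ha q x μ‖ ≤ ∑ k, ‖bAt n hn M a ha q k μ‖ := by
  unfold lamp
  refine (norm_sum_le _ _).trans (le_of_eq (Finset.sum_congr rfl fun k _ => ?_))
  rw [norm_mul, norm_chi, one_mul]

/-- `|β_{p′}(x,μ)| ≤ L_b Δ₀√Δ₀`. [folklore] -/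
theorem norm_lamp_le' (hd : 0 < d) {q : Tor M} (hq : q ≠ 0) (x : Tor (fine n M)) (μ : Fin d) :
    ‖lamp n hn M a ha q x μ‖
      ≤ legC d a * ((B5FiberQQ.fiberAt n M hn a ha q hq).Δ₀ * Real.sqrt (B5FiberQQ.fiberAt n M hn a ha q hq).Δ₀) :=
  (norm_lamp_le n hn M a ha q x μ).trans (sum_norm_bAt_le n hn M a ha hd hq μ)

/-- the DIFFERENCED LEG AMPLITUDE `β_{p′}(x + e_ρ, μ) − β_{p′}(x, μ) = Σ_l e^{i(p′+l)·x}(e^{i(p′+l)·e_ρ} − 1) b(l,μ)`.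
[folklore] -/
def dlamp (q : Tor M) (ρ : Fin d) (x : Tor (fine n M)) (μ : Fin d) : ℂ :=
  lamp n hn M a ha q (x + unitVec (fine n M) ρ) μ - lamp n hn M a ha q x μ

/-- `β_{p′}(x+e_ρ,μ) − β_{p′}(x,μ) = Σ_l e^{i(p′+l)·x}(e^{i(p′+l)·e_ρ} − 1) b(l,μ)`. [folklore] -/
theorem dlamp_eq (q : Tor M) (ρ : Fin d) (x : Tor (fine n M)) (μ : Fin d) :
    dlamp n hn M a ha q ρ x μ
      = ∑ k, chi (fine n M) (pOf n M (k, q)) x * (chi (fine n M) (pOf n M (k, q)) (unitVec (fine n M) ρ) - 1)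
          * bAt n hn M a ha q k μ := by
  unfold dlamp lamp
  rw [← Finset.sum_sub_distrib]
  refine Finset.sum_congr rfl fun k _ => ?_
  rw [chi_add_right]
  ring

/-- **ONE LATTICE DIFFERENCE COSTS `√Δ(p′+l)/n` PER LEG TERM**:
`|β_{p′}(x+e_ρ,μ) − β_{p′}(x,μ)| ≤ n⁻¹ Σ_l |b(l,μ)| √Δ(p′+l) ≤ L′_b Δ₀√Δ₀ / n`. [folklore] -/
theorem norm_dlamp_le (hd : 0 < d) {q : Tor M} (hq : q ≠ 0) (ρ : Fin d) (x : Tor (fine n M)) (μ : Fin d) :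
    ‖dlamp n hn M a ha q ρ x μ‖
      ≤ legC2 d a / n * ((B5FiberQQ.fiberAt n M hn a ha q hq).Δ₀ * Real.sqrt (B5FiberQQ.fiberAt n M hn a ha q hq).Δ₀) := by
  have hnr : (0 : ℝ) < n := by exact_mod_cast hn
  have h1 : ‖dlamp n hn M a ha q ρ x μ‖
      ≤ (∑ k, ‖(B5FiberQQ.fiberAt n M hn a ha q hq).b k μ‖
          * Real.sqrt ((B5FiberQQ.fiberAt n M hn a ha q hq).Δ k)) / n := by
    rw [dlamp_eq, Finset.sum_div]
    refine (norm_sum_le _ _).trans (Finset.sum_le_sum fun k _ => ?_)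
    rw [norm_mul, norm_mul, norm_chi, one_mul, bAt_of_ne n hn M a ha hq]
    have h := norm_chi_unitVec_sub_one_le n M (m2 := 0) le_rfl (pOf n M (k, q)) ρ
    rw [lapSym_pOf n M 0 k q] at h
    calc ‖chi (fine n M) (pOf n M (k, q)) (unitVec (fine n M) ρ) - 1‖ * ‖(B5FiberQQ.fiberAt n M hn a ha q hq).b k μ‖
        ≤ Real.sqrt (DeltaXir n 0 (shiftr n k (sOf M q))) / n * ‖(B5FiberQQ.fiberAt n M hn a ha q hq).b k μ‖ :=
          mul_le_mul_of_nonneg_right h (norm_nonneg _)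
      _ = ‖(B5FiberQQ.fiberAt n M hn a ha q hq).b k μ‖ * Real.sqrt ((B5FiberQQ.fiberAt n M hn a ha q hq).Δ k) / n := by
          show Real.sqrt (DeltaXir n 0 (shiftr n k (sOf M q))) / n * ‖(B5FiberQQ.fiberAt n M hn a ha q hq).b k μ‖
            = ‖(B5FiberQQ.fiberAt n M hn a ha q hq).b k μ‖ * Real.sqrt (DeltaXir n 0 (shiftr n k (sOf M q))) / n
          ring
  refine h1.trans ?_
  rw [div_le_iff₀ hnr]
  have h2 := sum_norm_b_sqrt_fiberAt_le n hn M a ha hd hq μ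
  calc ∑ k, ‖(B5FiberQQ.fiberAt n M hn a ha q hq).b k μ‖ * Real.sqrt ((B5FiberQQ.fiberAt n M hn a ha q hq).Δ k)
      ≤ legC2 d a * ((B5FiberQQ.fiberAt n M hn a ha q hq).Δ₀ * Real.sqrt (B5FiberQQ.fiberAt n M hn a ha q hq).Δ₀) := h2
    _ = legC2 d a / n * ((B5FiberQQ.fiberAt n M hn a ha q hq).Δ₀ * Real.sqrt (B5FiberQQ.fiberAt n M hn a ha q hq).Δ₀) * n := by
        field_simp

/-- **(G22-c) AT KERNEL GRADE — THE FIBRE TERM OF LINE 3 CARRIES THE FACTOR `Δ₀(p′)`**: for two legs `A`, `B`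
with `|A| ≤ C_A Δ₀√Δ₀`, `|B| ≤ C_B Δ₀√Δ₀` one has `|a⁻¹Φ(p′)⁻¹ A conj B| ≤ (γ₊ C_A C_B / a) · Δ₀(p′)`:
NO small denominator survives in line 3 — it vanishes to second order as `p′ → 0` (B5 p.32: «we get the
additional factor Δ₀²(p′). This factor multiplying the function between the square bracket expressions gives an
inverse of the expression (1.86) which is also well defined»; one more `Δ₀` than Bałaban needs, from `|∂(p′)| ≤ κ√Δ₀`,
`|∂₁| ≤ √Δ₀`).  [cite: Balaban1984PropagatorsI, (1.88) p.32 (proof ours)] -/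
theorem fibre_term_le {q : Tor M} (hq : q ≠ 0) {A B : ℂ} {CA CB : ℝ} (hCA : 0 ≤ CA)
    (hA : ‖A‖ ≤ CA * ((B5FiberQQ.fiberAt n M hn a ha q hq).Δ₀ * Real.sqrt (B5FiberQQ.fiberAt n M hn a ha q hq).Δ₀))
    (hB : ‖B‖ ≤ CB * ((B5FiberQQ.fiberAt n M hn a ha q hq).Δ₀ * Real.sqrt (B5FiberQQ.fiberAt n M hn a ha q hq).Δ₀)) :
    ‖cTAt n hn M a ha q * (A * conj B)‖ ≤ gammaPlus d a * CA * CB / a * (B5FiberQQ.fiberAt n M hn a ha q hq).Δ₀ := by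
  rw [norm_mul, norm_mul, Complex.norm_conj, cTAt_of_ne n hn M a ha hq, ← mul_assoc]
  exact cT_mul_legs_le (B5FiberQQ.fiberAt n M hn a ha q hq) hCA (norm_nonneg _) (norm_nonneg _) hA hB

/-- `Δ₀(p′) ≤ 4d` at every fibre. [folklore] -/
theorem Δ₀_fiberAt_le {q : Tor M} (hq : q ≠ 0) : (B5FiberQQ.fiberAt n M hn a ha q hq).Δ₀ ≤ 4 * d :=
  (B5FiberQQ.fiberAt n M hn a ha q hq).Δ₀_le

/-- **SUMMING THE FIBRES**: a per-fibre bound `K Δ₀(p′)` (`Δ₀ ≤ 4d`, `|T_{coarse}|` fibres, prefactor `|T_{fine}|⁻¹ =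
n^{-d}|T_{coarse}|⁻¹`) gives `|⟨A,B⟩_𝓛| ≤ 4dK / n^d`. [folklore] -/
theorem norm_fsum_le {K : ℝ} (hK : 0 ≤ K) (A B : Tor M → ℂ)
    (h : ∀ (q : Tor M) (hq : q ≠ 0),
      ‖cTAt n hn M a ha q * (A q * conj (B q))‖ ≤ K * (B5FiberQQ.fiberAt n M hn a ha q hq).Δ₀) :
    ‖fsum n hn M a ha A B‖ ≤ 4 * d * K / (n : ℝ) ^ d := by
  have hnr : (0 : ℝ) < n := by exact_mod_cast hn
  have hnd : (0 : ℝ) < (n : ℝ) ^ d := pow_pos hnr d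
  have hcM : (0 : ℝ) < Fintype.card (Tor M) := by exact_mod_cast Fintype.card_pos
  have hd : (0 : ℝ) ≤ d := Nat.cast_nonneg d
  have hterm : ∀ q : Tor M, ‖cTAt n hn M a ha q * (A q * conj (B q))‖ ≤ 4 * d * K := by
    intro q
    by_cases hq : q = 0
    · subst hq
      rw [cTAt_zero, zero_mul, norm_zero]
      positivity
    · refine (h q hq).trans ?_
      calc K * (B5FiberQQ.fiberAt n M hn a ha q hq).Δ₀ ≤ K * (4 * d) :=
            mul_le_mul_of_nonneg_left (Δ₀_fiberAt_le n hn M a ha hq) hK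
        _ = 4 * d * K := by ring
  unfold fsum
  rw [norm_mul, norm_inv, Complex.norm_natCast, B5Block118.card_fine n M]
  calc ((n : ℝ) ^ d * Fintype.card (Tor M))⁻¹ * ‖∑ q, cTAt n hn M a ha q * (A q * conj (B q))‖
      ≤ ((n : ℝ) ^ d * Fintype.card (Tor M))⁻¹ * ∑ q, ‖cTAt n hn M a ha q * (A q * conj (B q))‖ :=
        mul_le_mul_of_nonneg_left (norm_sum_le _ _) (inv_nonneg.mpr (mul_pos hnd hcM).le)
    _ ≤ ((n : ℝ) ^ d * Fintype.card (Tor M))⁻¹ * ∑ _q : Tor M, 4 * d * K :=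
        mul_le_mul_of_nonneg_left (Finset.sum_le_sum fun q _ => hterm q) (inv_nonneg.mpr (mul_pos hnd hcM).le)
    _ = 4 * d * K / (n : ℝ) ^ d := by
        rw [Finset.sum_const, Finset.card_univ, nsmul_eq_mul]
        field_simp

/-- `C₀(d,a) = 4d γ₊ L_b²/a`. [folklore] -/
def ellD0 (d : ℕ) (a : ℝ) : ℝ := 4 * d * (gammaPlus d a * legC d a * legC d a / a)

/-- `C₁(d,a) = 4d γ₊ L′_b L_b/a`. [folklore] -/
def ellD1 (d : ℕ) (a : ℝ) : ℝ := 4 * d * (gammaPlus d a * legC2 d a * legC d a / a)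

/-- `C₂(d,a) = 4d γ₊ L′_b²/a`. [folklore] -/
def ellD2 (d : ℕ) (a : ℝ) : ℝ := 4 * d * (gammaPlus d a * legC2 d a * legC2 d a / a)

/-- **(K0) THE LONGITUDINAL KERNEL IS FLAT OF SIZE `n^{-d}`**: `|𝓛((x,μ),(x′,ν))| ≤ C₀(d,a)/n^d` for every
`d ≥ 1`, all periods, every `a > 0`, `n ≥ 1` (the `n = L^k = η⁻¹` scaling units of `calG`, `c = n²`).
[cite: Balaban1984PropagatorsI, Proposition 1.1 p.33 (line 3 of (1.83); proof ours)] -/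
theorem norm_Lker_le (hd : 0 < d) (x : Tor (fine n M)) (μ : Fin d) (x' : Tor (fine n M)) (ν : Fin d) :
    ‖Lker n hn M a ha x μ x' ν‖ ≤ ellD0 d a / (n : ℝ) ^ d := by
  rw [Lker_eq_fsum, ellD0]
  have hγ := gammaPlus_pos' (d := d) ha
  have hL := legC_nonneg (d := d) ha
  exact norm_fsum_le n hn M a ha (by positivity) _ _ fun q hq =>
    fibre_term_le n hn M a ha hq hL (norm_lamp_le' n hn M a ha hd hq x μ) (norm_lamp_le' n hn M a ha hd hq x' ν)

/-- **(K1) ONE LATTICE DIFFERENCE IN THE FIRST LEG GAINS `n⁻¹`**: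
`|𝓛((x+e_ρ,μ),(x′,ν)) − 𝓛((x,μ),(x′,ν))| ≤ C₁(d,a)/n^{d+1}`.
[cite: Balaban1984PropagatorsI, Proposition 1.1 p.33 (line 3 of (1.83); proof ours)] -/
theorem norm_Lker_sub_left_le (hd : 0 < d) (ρ : Fin d) (x : Tor (fine n M)) (μ : Fin d) (x' : Tor (fine n M))
    (ν : Fin d) :
    ‖Lker n hn M a ha (x + unitVec (fine n M) ρ) μ x' ν - Lker n hn M a ha x μ x' ν‖
      ≤ ellD1 d a / (n : ℝ) ^ (d + 1) := by
  rw [Lker_eq_fsum, Lker_eq_fsum, ← fsum_sub_left]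
  have hnr : (0 : ℝ) < n := by exact_mod_cast hn
  have hγ := gammaPlus_pos' (d := d) ha
  have hL := legC_nonneg (d := d) ha
  have hL2 := legC2_nonneg (d := d) ha
  have h := norm_fsum_le n hn M a ha (K := gammaPlus d a * (legC2 d a / n) * legC d a / a) (by positivity)
    (fun q => lamp n hn M a ha q (x + unitVec (fine n M) ρ) μ - lamp n hn M a ha q x μ)
    (fun q => lamp n hn M a ha q x' ν)
    fun q hq => fibre_term_le n hn M a ha hq (div_nonneg hL2 hnr.le) (norm_dlamp_le n hn M a ha hd hq ρ x μ)
      (norm_lamp_le' n hn M a ha hd hq x' ν)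
  refine h.trans (le_of_eq ?_)
  rw [ellD1, pow_succ]
  field_simp

/-- **(K1′) ONE LATTICE DIFFERENCE IN THE SECOND LEG GAINS `n⁻¹`**:
`|𝓛((x,μ),(x′+e_ρ,ν)) − 𝓛((x,μ),(x′,ν))| ≤ C₁(d,a)/n^{d+1}`.
[cite: Balaban1984PropagatorsI, Proposition 1.1 p.33 (line 3 of (1.83); proof ours)] -/
theorem norm_Lker_sub_right_le (hd : 0 < d) (ρ : Fin d) (x : Tor (fine n M)) (μ : Fin d) (x' : Tor (fine n M))
    (ν : Fin d) :
    ‖Lker n hn M a ha x μ (x' + unitVec (fine n M) ρ) ν - Lker n hn M a ha x μ x' ν‖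
      ≤ ellD1 d a / (n : ℝ) ^ (d + 1) := by
  rw [Lker_eq_fsum, Lker_eq_fsum, ← fsum_sub_right]
  have hnr : (0 : ℝ) < n := by exact_mod_cast hn
  have hγ := gammaPlus_pos' (d := d) ha
  have hL := legC_nonneg (d := d) ha
  have hL2 := legC2_nonneg (d := d) ha
  have h := norm_fsum_le n hn M a ha (K := gammaPlus d a * legC d a * (legC2 d a / n) / a) (by positivity)
    (fun q => lamp n hn M a ha q x μ)
    (fun q => lamp n hn M a ha q (x' + unitVec (fine n M) ρ) ν - lamp n hn M a ha q x' ν)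
    fun q hq => fibre_term_le n hn M a ha hq hL (norm_lamp_le' n hn M a ha hd hq x μ)
      (norm_dlamp_le n hn M a ha hd hq ρ x' ν)
  refine h.trans (le_of_eq ?_)
  rw [ellD1, pow_succ]
  field_simp

/-- **(K2) ONE LATTICE DIFFERENCE IN EACH LEG GAINS `n⁻²`**:
`|∇_ρ∇′_{ρ′}𝓛((x,μ),(x′,ν))| ≤ C₂(d,a)/n^{d+2}`.
[cite: Balaban1984PropagatorsI, Proposition 1.1 p.33 (line 3 of (1.83); proof ours)] -/
theorem norm_Lker_sub_sub_le (hd : 0 < d) (ρ ρ' : Fin d) (x : Tor (fine n M)) (μ : Fin d) (x' : Tor (fine n M))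
    (ν : Fin d) :
    ‖(Lker n hn M a ha (x + unitVec (fine n M) ρ) μ (x' + unitVec (fine n M) ρ') ν
          - Lker n hn M a ha x μ (x' + unitVec (fine n M) ρ') ν)
        - (Lker n hn M a ha (x + unitVec (fine n M) ρ) μ x' ν - Lker n hn M a ha x μ x' ν)‖
      ≤ ellD2 d a / (n : ℝ) ^ (d + 2) := by
  simp only [Lker_eq_fsum]
  rw [← fsum_sub_left, ← fsum_sub_left, ← fsum_sub_right]
  have hnr : (0 : ℝ) < n := by exact_mod_cast hn
  have hγ := gammaPlus_pos' (d := d) ha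
  have hL2 := legC2_nonneg (d := d) ha
  have h := norm_fsum_le n hn M a ha (K := gammaPlus d a * (legC2 d a / n) * (legC2 d a / n) / a) (by positivity)
    (fun q => lamp n hn M a ha q (x + unitVec (fine n M) ρ) μ - lamp n hn M a ha q x μ)
    (fun q => lamp n hn M a ha q (x' + unitVec (fine n M) ρ') ν - lamp n hn M a ha q x' ν)
    fun q hq => fibre_term_le n hn M a ha hq (div_nonneg hL2 hnr.le) (norm_dlamp_le n hn M a ha hd hq ρ x μ)
      (norm_dlamp_le n hn M a ha hd hq ρ' x' ν)
  refine h.trans (le_of_eq ?_)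
  rw [ellD2, pow_add]
  field_simp

/-- `Δ₀(p′) = Σ_μ (2 − 2cos p′_μ)` at the fibre over `q ↔ p′` — the factor carried by (G22-c) is of degree two in `p′`.
[folklore] -/
theorem Δ₀_fiberAt_eq {q : Tor M} (hq : q ≠ 0) : (B5FiberQQ.fiberAt n M hn a ha q hq).Δ₀ = Delta1r 0 (sOf M q) := by
  rw [Delta0_eq]
  rfl

/-- **(G22-c) THE FIBRE TERM OF LINE 3 WITH ITS LEGS**:
`|a⁻¹Φ(p′)⁻¹ β_{p′}(x,μ) \overline{β_{p′}(x′,ν)}| ≤ (γ₊ L_b(d,a)²/a) · Δ₀(p′)` — uniformly in `x, x′, μ, ν`, the periods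
and `n`; it vanishes to second order as `p′ → 0`. [cite: Balaban1984PropagatorsI, (1.88) p.32 (proof ours)] -/
theorem fibre_term_lamp_le (hd : 0 < d) {q : Tor M} (hq : q ≠ 0) (x : Tor (fine n M)) (μ : Fin d)
    (x' : Tor (fine n M)) (ν : Fin d) :
    ‖cTAt n hn M a ha q * (lamp n hn M a ha q x μ * conj (lamp n hn M a ha q x' ν))‖
      ≤ gammaPlus d a * legC d a * legC d a / a * (B5FiberQQ.fiberAt n M hn a ha q hq).Δ₀ :=
  fibre_term_le n hn M a ha hq (legC_nonneg (d := d) ha) (norm_lamp_le' n hn M a ha hd hq x μ)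
    (norm_lamp_le' n hn M a ha hd hq x' ν)

/-- **THE WINDOW-GRADE PACKAGE FOR LINE 3 OF (1.83)** (K0, K1 in either leg, K2), stated for the kernel of
`𝒢 − ⊕_μΓ_μ` (`= U^*𝓛̂U =` the Woodbury longitudinal term): every `d ≥ 1`, all periods, every `a > 0`, `n ≥ 1`;
constants `C₀, C₁, C₂` depend on `(d, a)` only. [cite: Balaban1984PropagatorsI, Proposition 1.1 p.33 (line 3; proof ours)] -/
theorem window_bounds (hd : 0 < d) :
    (∀ (x : Tor (fine n M)) (μ : Fin d) (x' : Tor (fine n M)) (ν : Fin d),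
        ‖(calG n hn M a ha - gammaSum n M a) (x, μ) (x', ν)‖ ≤ ellD0 d a / (n : ℝ) ^ d) ∧
    (∀ (ρ : Fin d) (x : Tor (fine n M)) (μ : Fin d) (x' : Tor (fine n M)) (ν : Fin d),
        ‖(calG n hn M a ha - gammaSum n M a) (x + unitVec (fine n M) ρ, μ) (x', ν)
            - (calG n hn M a ha - gammaSum n M a) (x, μ) (x', ν)‖ ≤ ellD1 d a / (n : ℝ) ^ (d + 1)) ∧
    (∀ (ρ : Fin d) (x : Tor (fine n M)) (μ : Fin d) (x' : Tor (fine n M)) (ν : Fin d),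
        ‖(calG n hn M a ha - gammaSum n M a) (x, μ) (x' + unitVec (fine n M) ρ, ν)
            - (calG n hn M a ha - gammaSum n M a) (x, μ) (x', ν)‖ ≤ ellD1 d a / (n : ℝ) ^ (d + 1)) ∧
    (∀ (ρ ρ' : Fin d) (x : Tor (fine n M)) (μ : Fin d) (x' : Tor (fine n M)) (ν : Fin d),
        ‖((calG n hn M a ha - gammaSum n M a) (x + unitVec (fine n M) ρ, μ) (x' + unitVec (fine n M) ρ', ν)
              - (calG n hn M a ha - gammaSum n M a) (x, μ) (x' + unitVec (fine n M) ρ', ν))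
            - ((calG n hn M a ha - gammaSum n M a) (x + unitVec (fine n M) ρ, μ) (x', ν)
              - (calG n hn M a ha - gammaSum n M a) (x, μ) (x', ν))‖ ≤ ellD2 d a / (n : ℝ) ^ (d + 2)) := by
  refine ⟨fun x μ x' ν => ?_, fun ρ x μ x' ν => ?_, fun ρ x μ x' ν => ?_, fun ρ ρ' x μ x' ν => ?_⟩
  · rw [calG_sub_gammaSum_apply]
    exact norm_Lker_le n hn M a ha hd x μ x' ν
  · rw [calG_sub_gammaSum_apply, calG_sub_gammaSum_apply]
    exact norm_Lker_sub_left_le n hn M a ha hd ρ x μ x' ν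
  · rw [calG_sub_gammaSum_apply, calG_sub_gammaSum_apply]
    exact norm_Lker_sub_right_le n hn M a ha hd ρ x μ x' ν
  · rw [calG_sub_gammaSum_apply, calG_sub_gammaSum_apply, calG_sub_gammaSum_apply, calG_sub_gammaSum_apply]
    exact norm_Lker_sub_sub_le n hn M a ha hd ρ ρ' x μ x' ν

/-- `C₀(4,a)`, `C₁(4,a)`, `C₂(4,a)` are the `d = 4` window constants; e.g. the flat size is `C₀(4,a)/n⁴` — the grade of
`WoodburyFibre`'s `Rperp` (`O(N⁻⁴)`). [folklore] -/
theorem window_bounds_four (M : Fin 4 → ℕ) [∀ μ, NeZero (M μ)] (x : Tor (fine n M)) (μ : Fin 4) (x' : Tor (fine n M))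
    (ν : Fin 4) : ‖(calG n hn M a ha - gammaSum n M a) (x, μ) (x', ν)‖ ≤ ellD0 4 a / (n : ℝ) ^ 4 :=
  (window_bounds n hn M a ha (by norm_num)).1 x μ x' ν

end Bounds

end Literature.MathematicalPhysics.QuantumFieldTheory.Balaban1983to89.Beta.LongitudinalWindow

end
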